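import Summits.Ventures.PercRepro.C026PFunStarDel
import Summits.Ventures.PercRepro.C026PFunStarPos
import Summits.Ventures.PercRepro.C026PFunSlack

/-!
# Edge-monotonicity at the corners on stars (p6, gen 16; mine-3 §29 (c), EM(corner))

For the `k`-star and a pendant edge `j`, with `S = ι \ {j}`,
`(P_star) − (P_{star − e_j}) = ∏_{i∈S}(3 − x_i) − 2^k Z_A x_j + 2K_A∏_{i∈S}(1 + n̄_iK_i)·β_j − K_AZ_A∏_{i∈S}(n̄_iK_i + x_i)·γ_j`
with `β_j = n̄_jK_j − (1 − x_j)`, `γ_j = n̄_jK_j − 2(1 − x_j)` (`em_star_eq`).  At the lower corners the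
special vertex `j` contributes the triple `(1, β_j, γ_j)`, an affine interpolation between two of the
three SPECIAL TYPES `E₀* = (1, −1, −2)`, `HALF* = (1, −½, −1)`, `BARE* = (1, 1, 1)` (with `x_j = 0, ½, 1`),
and the other vertices their usual types; the tensor expansion reduces EM(corner) to the type values
`(5/2)^j3^m − 2^{j+m+1}Z·x* + K_min(Z)·(2β* − Z·2^{−j}[m = 0]·γ*)`, each `≥ 0` (`emTypeValue_nonneg`).
**THEOREM (`em_star_corner`)**: EM(corner) holds on every star at every pendant edge.
-/

namespace PercRepro

namespace MultiGraph

open Finset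

variable {ι : Type*} [Fintype ι] [DecidableEq ι]

/-- **The EM difference of the star at the pendant edge `j`, in closed form.** -/
theorem em_star_eq (x K : Option ι → ℝ) (j : ι) :
    (star ι).pFun none x K univ - (star ι).pFun none x K (univ.erase j) =
      (∏ i ∈ univ.erase j, (3 - x (some i))) - 2 ^ (Fintype.card ι) * x none * x (some j) +
        2 * K none * (∏ i ∈ univ.erase j, (1 + (2 - x (some i)) * K (some i))) *
          ((2 - x (some j)) * K (some j) - (1 - x (some j))) -
        K none * x none * (∏ i ∈ univ.erase j, ((2 - x (some i)) * K (some i) + x (some i))) *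
          ((2 - x (some j)) * K (some j) - 2 * (1 - x (some j))) := by
  rw [pFun_star_eq, pFun_star_erase_eq]
  have hcard : Fintype.card ι - 1 + 1 = Fintype.card ι := by
    have : 0 < Fintype.card ι := Fintype.card_pos_iff.2 ⟨j⟩
    omega
  rw [hcard, ← Finset.mul_prod_erase univ (fun i => (3 - x (some i))) (Finset.mem_univ j),
    ← Finset.mul_prod_erase univ (fun i => (1 + (2 - x (some i)) * K (some i))) (Finset.mem_univ j),
    ← Finset.mul_prod_erase univ (fun i => ((2 - x (some i)) * K (some i) + x (some i)))
      (Finset.mem_univ j)]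
  ring

/-! ### The special-vertex arithmetic -/

/-- `5^j − 4^j − 2^j + 1 ≥ 0`. -/
theorem five_four_two_ineq (j : ℕ) : (4 : ℝ) ^ j + 2 ^ j ≤ 5 ^ j + 1 := by
  induction j with
  | zero => norm_num
  | succ j ih =>
    have h2 : (1 : ℝ) ≤ 2 ^ j := one_le_pow₀ (by norm_num)
    have h4 : (1 : ℝ) ≤ 4 ^ j := one_le_pow₀ (by norm_num)
    rw [pow_succ, pow_succ, pow_succ]
    nlinarith [ih, h2, h4]

/-- `3^m ≥ 2^m + 1` for `m ≥ 1`. -/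
theorem three_pow_ge_two_pow_succ (m : ℕ) (hm : 1 ≤ m) : (2 : ℝ) ^ m + 1 ≤ 3 ^ m := by
  induction m with
  | zero => omega
  | succ m ih =>
    rcases Nat.eq_zero_or_pos m with rfl | hm'
    · norm_num
    · have := ih hm'
      have h2 : (1 : ℝ) ≤ 2 ^ m := one_le_pow₀ (by norm_num)
      rw [pow_succ, pow_succ]
      nlinarith [this, h2]

/-- The key inequality of the `HALF*` case: `(5/2)^j 3^m + 2^{−j}[m = 0] ≥ 2^{j+m} + 1`. -/
theorem em_half_ineq (j m : ℕ) :
    (2 : ℝ) ^ (j + m) + 1 ≤ (5 / 2) ^ j * 3 ^ m + (1 / 2) ^ j * (0 : ℝ) ^ m := by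
  rcases Nat.eq_zero_or_pos m with rfl | hm
  · simp only [pow_zero, mul_one, add_zero]
    have h2j : (0 : ℝ) < 2 ^ j := by positivity
    have h5 : (2 : ℝ) ^ j * (5 / 2) ^ j = 5 ^ j := by rw [← mul_pow]; norm_num
    have hh : (2 : ℝ) ^ j * (1 / 2) ^ j = 1 := by rw [← mul_pow]; norm_num
    have h4 : (4 : ℝ) ^ j = 2 ^ j * 2 ^ j := by rw [← mul_pow]; norm_num
    have key := five_four_two_ineq j
    rw [h4] at key
    have : (2 : ℝ) ^ j * ((2 : ℝ) ^ j + 1) ≤ 2 ^ j * ((5 / 2) ^ j + (1 / 2) ^ j) := by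
      nlinarith [h5, hh, key]
    exact le_of_mul_le_mul_left this h2j
  · rw [zero_pow (by omega), mul_zero, add_zero, pow_add]
    have h3 := three_pow_ge_two_pow_succ m hm
    have h52 : (2 : ℝ) ^ j ≤ (5 / 2) ^ j := pow_le_pow_left₀ (by norm_num) (by norm_num) j
    have h2j : (1 : ℝ) ≤ 2 ^ j := one_le_pow₀ (by norm_num)
    have h2m : (0 : ℝ) ≤ 2 ^ m := by positivity
    nlinarith [mul_le_mul h52 h3 (by positivity) (by positivity), h2j, h2m]

/-- The special types `E₀* = (0, −1, −2)`, `HALF* = (½, −½, −1)`, `BARE* = (1, 1, 1)`: the `x`-value. -/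
noncomputable def xS : Fin 3 → ℝ := ![0, 1 / 2, 1]
/-- The `β`-value of the special types. -/
noncomputable def βS : Fin 3 → ℝ := ![-1, -1 / 2, 1]
/-- The `γ`-value of the special types. -/
noncomputable def γS : Fin 3 → ℝ := ![-2, -1, 1]

/-- The EM value at a type assignment (`n` BARE, `j` HALF, `m` E₀ among the other vertices, the special
vertex of type `s`). -/
noncomputable def emTypeValue (n j m : ℕ) (s : Fin 3) (Z KA : ℝ) : ℝ :=
  3 ^ m * (5 / 2) ^ j * 2 ^ n - 2 ^ (n + j + m + 1) * Z * xS s +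
    2 * KA * (1 ^ m * 1 ^ j * 2 ^ n) * βS s - KA * Z * ((0 : ℝ) ^ m * (1 / 2) ^ j * 2 ^ n) * γS s

/-- The EM value factors `2^n`. -/
theorem emTypeValue_eq (n j m : ℕ) (s : Fin 3) (Z KA : ℝ) :
    emTypeValue n j m s Z KA = 2 ^ n * ((5 / 2) ^ j * 3 ^ m - 2 ^ (j + m + 1) * Z * xS s +
      KA * (2 * βS s - Z * ((0 : ℝ) ^ m * (1 / 2) ^ j) * γS s)) := by
  unfold emTypeValue
  rw [show n + j + m + 1 = (j + m + 1) + n by omega, pow_add]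
  ring

/-- **The EM type inequality**: every EM type value is `≥ 0` at the probe's lower corner. -/
theorem emTypeValue_nonneg (n j m : ℕ) (s : Fin 3) {Z : ℝ} (hZ : 0 ≤ Z ∧ Z ≤ 1) :
    0 ≤ emTypeValue n j m s Z (kMin Z) := by
  rw [emTypeValue_eq]
  refine mul_nonneg (by positivity) ?_
  have hA : (2 : ℝ) ^ (j + m) ≤ (5 / 2) ^ j * 3 ^ m := five_half_three_pow_ge j m
  have hc0 : 0 ≤ (0 : ℝ) ^ m * (1 / 2) ^ j := by positivity
  have hc1 : (0 : ℝ) ^ m * (1 / 2) ^ j ≤ 1 := by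
    rcases Nat.eq_zero_or_pos m with rfl | hm
    · simp only [pow_zero, one_mul]
      exact pow_le_one₀ (by norm_num) (by norm_num)
    · rw [zero_pow (by omega), zero_mul]; norm_num
  have hk0 := kMin_nonneg Z
  have hk1 : kMin Z ≤ 1 := by
    rcases le_or_gt Z (1 / 2) with h | h
    · rw [kMin_eq_zero_of_le h]; norm_num
    · rw [kMin_eq_of_half_le h.le hZ.2, div_le_one (by linarith)]; linarith
  rcases s with ⟨k, hk⟩
  interval_cases k
  · -- E₀*: `A − 2K_min(Z)(1 − Zc) ≥ 0`
    have e1 : xS ⟨0, hk⟩ = 0 := rfl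
    have e2 : βS ⟨0, hk⟩ = -1 := rfl
    have e3 : γS ⟨0, hk⟩ = -2 := rfl
    rw [e1, e2, e3]
    rcases le_or_gt Z (1 / 2) with h | h
    · rw [kMin_eq_zero_of_le h]
      have : (0 : ℝ) ≤ 2 ^ (j + m) := by positivity
      nlinarith [hA]
    · -- `kMin ≤ 1`, `1 − Zc ≤ 1 − c/2`, and `A − 2 + c ≥ 0`
      have hAc : 2 ≤ (5 / 2) ^ j * 3 ^ m + (0 : ℝ) ^ m * (1 / 2) ^ j := by
        rcases Nat.eq_zero_or_pos m with rfl | hm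
        · simp only [pow_zero, mul_one, one_mul]
          rcases Nat.eq_zero_or_pos j with rfl | hj
          · norm_num
          · have : (5 / 2 : ℝ) ≤ (5 / 2) ^ j := by
              calc (5 / 2 : ℝ) = (5 / 2) ^ 1 := by norm_num
                _ ≤ (5 / 2) ^ j := pow_le_pow_right₀ (by norm_num) hj
            have : (0 : ℝ) ≤ (1 / 2) ^ j := by positivity
            linarith
        · rw [zero_pow (by omega), zero_mul, add_zero]
          have : (3 : ℝ) ≤ 3 ^ m := by
            calc (3 : ℝ) = 3 ^ 1 := by norm_num
              _ ≤ 3 ^ m := pow_le_pow_right₀ (by norm_num) hm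
          have : (1 : ℝ) ≤ (5 / 2) ^ j := one_le_pow₀ (by norm_num)
          nlinarith
      have hZc : Z * ((0 : ℝ) ^ m * (1 / 2) ^ j) ≥ ((0 : ℝ) ^ m * (1 / 2) ^ j) / 2 := by
        nlinarith [hc0]
      -- goal: A − B·Z·0 + K(2·(−1) − Zc·(−2)) = A − 2K(1 − Zc) ≥ 0
      have h1 : (0 : ℝ) ≤ 2 - 2 * (Z * ((0 : ℝ) ^ m * (1 / 2) ^ j)) := by nlinarith [hc1, hZ.2, hc0]
      have h2 := mul_le_mul_of_nonneg_right hk1 h1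
      nlinarith [h2, hAc, hZc, hk0]
  · -- HALF*: `A − BZ − K_min(Z)(1 − Zc) ≥ 0`
    have e1 : xS ⟨1, hk⟩ = 1 / 2 := rfl
    have e2 : βS ⟨1, hk⟩ = -1 / 2 := rfl
    have e3 : γS ⟨1, hk⟩ = -1 := rfl
    rw [e1, e2, e3]
    rcases le_or_gt Z (1 / 2) with h | h
    · rw [kMin_eq_zero_of_le h]
      have : (0 : ℝ) ≤ 2 ^ (j + m) := by positivity
      rw [pow_succ]
      nlinarith [hA, mul_nonneg this (by linarith : 0 ≤ 1 - 2 * Z)]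
    · have h2Z : 0 < 2 - Z := by linarith
      rw [kMin_eq_of_half_le h.le hZ.2]
      have hkey := em_half_ineq j m
      have hE : (2 - Z) * ((5 / 2) ^ j * 3 ^ m - 2 ^ (j + m + 1) * Z * (1 / 2) +
          (2 * Z - 1) / (2 - Z) * (2 * (-1 / 2) - Z * ((0 : ℝ) ^ m * (1 / 2) ^ j) * (-1))) =
          ((5 / 2) ^ j * 3 ^ m - 2 ^ (j + m) - 1 + (1 / 2) ^ j * (0 : ℝ) ^ m) +
            (1 - Z) * ((5 / 2) ^ j * 3 ^ m + 2 - 3 * ((1 / 2) ^ j * (0 : ℝ) ^ m)) +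
            (1 - Z) ^ 2 * (2 ^ (j + m) + 2 * ((1 / 2) ^ j * (0 : ℝ) ^ m)) := by
        field_simp
        ring
      have hpos : 0 ≤ ((5 / 2) ^ j * 3 ^ m - 2 ^ (j + m) - 1 + (1 / 2) ^ j * (0 : ℝ) ^ m) +
            (1 - Z) * ((5 / 2) ^ j * 3 ^ m + 2 - 3 * ((1 / 2) ^ j * (0 : ℝ) ^ m)) +
            (1 - Z) ^ 2 * (2 ^ (j + m) + 2 * ((1 / 2) ^ j * (0 : ℝ) ^ m)) := by
        have hc1' : (1 / 2 : ℝ) ^ j * (0 : ℝ) ^ m ≤ 1 := by rw [mul_comm]; exact hc1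
        have hA1 : (1 : ℝ) ≤ (5 / 2) ^ j * 3 ^ m := by
          have : (1 : ℝ) ≤ 2 ^ (j + m) := one_le_pow₀ (by norm_num)
          linarith
        refine add_nonneg (add_nonneg (by linarith) (mul_nonneg (by linarith) (by linarith))) ?_
        exact mul_nonneg (sq_nonneg _) (by positivity)
      have := (mul_nonneg_iff_of_pos_left h2Z).1 (hE ▸ hpos)
      exact this
  · -- BARE*: the star type value
    have e1 : xS ⟨2, hk⟩ = 1 := rfl
    have e2 : βS ⟨2, hk⟩ = 1 := rfl
    have e3 : γS ⟨2, hk⟩ = 1 := rfl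
    rw [e1, e2, e3]
    have := starTypeValue_nonneg n j m hZ
    rw [starTypeValue_eq] at this
    have h2n : (0 : ℝ) < 2 ^ n := by positivity
    have := (mul_nonneg_iff_of_pos_left h2n).1 this
    linarith [this]


/-! ### The tensor expansion over `ι \ {j}` and EM(corner) on stars -/

omit [Fintype ι] in
/-- The tensor expansion of a product of affine interpolations over a finite set. -/
theorem prod_affine_eq_sum_finset (s : Finset ι) (t A B : ι → ℝ) :
    ∏ i ∈ s, ((1 - t i) * A i + t i * B i) =
      ∑ T ∈ s.powerset, ((∏ i ∈ T, t i) * ∏ i ∈ s \ T, (1 - t i)) *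
        ∏ i ∈ s, (if i ∈ T then B i else A i) := by
  rw [Finset.prod_congr rfl fun i _ => show (1 - t i) * A i + t i * B i = t i * B i + (1 - t i) * A i
    by ring, Finset.prod_add]
  refine Finset.sum_congr rfl fun T hT => ?_
  have hT' := Finset.mem_powerset.1 hT
  rw [Finset.prod_mul_distrib, Finset.prod_mul_distrib, Finset.prod_ite, Finset.filter_mem_eq_inter,
    Finset.inter_eq_right.2 hT', Finset.filter_not, Finset.filter_mem_eq_inter,
    Finset.inter_eq_right.2 hT']
  ring

omit [Fintype ι] in
/-- The weights over a finite set sum to one. -/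
theorem sum_weights_eq_one_finset (s : Finset ι) (t : ι → ℝ) :
    ∑ T ∈ s.powerset, ((∏ i ∈ T, t i) * ∏ i ∈ s \ T, (1 - t i)) = 1 := by
  have h := prod_affine_eq_sum_finset s t (fun _ => (1 : ℝ)) (fun _ => (1 : ℝ))
  simp only [mul_one, ite_self, Finset.prod_const_one, sub_add_cancel] at h
  exact h.symm

omit [Fintype ι] in
/-- The weights over a finite set are nonnegative for `t ∈ [0, 1]`. -/
theorem weight_nonneg_finset {t : ι → ℝ} (ht : ∀ i, 0 ≤ t i ∧ t i ≤ 1) (s T : Finset ι) :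
    0 ≤ (∏ i ∈ T, t i) * ∏ i ∈ s \ T, (1 - t i) :=
  mul_nonneg (Finset.prod_nonneg fun i _ => (ht i).1)
    (Finset.prod_nonneg fun i _ => by linarith [(ht i).2])

omit [Fintype ι] [DecidableEq ι] in
/-- A product over a finite set of a function of a `Fin 3`-valued type assignment, by fibres. -/
theorem prod_fin3_comp_finset (s : Finset ι) (τ : ι → Fin 3) (f : Fin 3 → ℝ) :
    ∏ i ∈ s, f (τ i) = f 0 ^ (s.filter fun i => τ i = 0).card *
      f 1 ^ (s.filter fun i => τ i = 1).card * f 2 ^ (s.filter fun i => τ i = 2).card := by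
  rw [← Finset.prod_fiberwise_of_maps_to' (fun i _ => Finset.mem_univ (τ i)) f, Fin.prod_univ_three]
  simp only [Finset.prod_const]

omit [Fintype ι] [DecidableEq ι] in
/-- The fibre counts over a finite set add up to its size. -/
theorem card_eq_sum_fin3_finset (s : Finset ι) (τ : ι → Fin 3) :
    s.card = (s.filter fun i => τ i = 0).card + (s.filter fun i => τ i = 1).card +
      (s.filter fun i => τ i = 2).card := by
  rw [Finset.card_eq_sum_card_fiberwise (t := (univ : Finset (Fin 3))) (fun i _ => Finset.mem_univ (τ i)),
    Fin.sum_univ_three]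

/-- The special vertex's corner data `(x, β, γ)` interpolates between two special types. -/
theorem special_factors_eq {x : ℝ} (hx : 0 ≤ x ∧ x ≤ 1) :
    x = (1 - pieceT x) * xS (pieceLo x) + pieceT x * xS (pieceHi x) ∧
    (2 - x) * kMin x - (1 - x) = (1 - pieceT x) * βS (pieceLo x) + pieceT x * βS (pieceHi x) ∧
    (2 - x) * kMin x - 2 * (1 - x) = (1 - pieceT x) * γS (pieceLo x) + pieceT x * γS (pieceHi x) := by
  unfold pieceT pieceLo pieceHi kMin xS βS γS
  by_cases h : x ≤ 1 / 2
  · have hk : max 0 ((2 * x - 1) / (2 - x)) = 0 := by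
      rw [max_eq_left]
      apply div_nonpos_of_nonpos_of_nonneg <;> linarith
    simp only [if_pos h, hk]
    refine ⟨?_, ?_, ?_⟩ <;> simp <;> ring
  · have h2 : (2 : ℝ) - x ≠ 0 := by linarith
    have hk : max 0 ((2 * x - 1) / (2 - x)) = (2 * x - 1) / (2 - x) := by
      rw [max_eq_right]
      apply div_nonneg <;> linarith
    have hmul : (2 - x) * ((2 * x - 1) / (2 - x)) = 2 * x - 1 := by
      rw [mul_div_cancel₀ _ h2]
    simp only [if_neg h, hk, hmul]
    refine ⟨?_, ?_, ?_⟩ <;> simp <;> ring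

/-- The EM closed form at a type assignment of the other vertices and a special type `s` of the
vertex `j` is an `emTypeValue`. -/
theorem em_type_eq (j : ι) (τ : ι → Fin 3) (s : Fin 3) (Z KA : ℝ) :
    (∏ i ∈ univ.erase j, aT (τ i)) - 2 ^ (Fintype.card ι) * Z * xS s +
      2 * KA * (∏ i ∈ univ.erase j, bT (τ i)) * βS s -
      KA * Z * (∏ i ∈ univ.erase j, cT (τ i)) * γS s =
    emTypeValue ((univ.erase j).filter fun i => τ i = 2).card
      ((univ.erase j).filter fun i => τ i = 1).card ((univ.erase j).filter fun i => τ i = 0).card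
      s Z KA := by
  rw [prod_fin3_comp_finset _ τ aT, prod_fin3_comp_finset _ τ bT, prod_fin3_comp_finset _ τ cT]
  have hcard : Fintype.card ι = ((univ.erase j).filter fun i => τ i = 2).card +
      ((univ.erase j).filter fun i => τ i = 1).card + ((univ.erase j).filter fun i => τ i = 0).card + 1 := by
    have h1 := card_eq_sum_fin3_finset (univ.erase j) τ
    have h2 : (univ.erase j).card = Fintype.card ι - 1 := by
      rw [Finset.card_erase_of_mem (Finset.mem_univ j), Finset.card_univ]
    have h3 : 0 < Fintype.card ι := Fintype.card_pos_iff.2 ⟨j⟩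
    omega
  rw [hcard]
  unfold emTypeValue
  simp only [aT, bT, cT, Matrix.cons_val_zero, Matrix.cons_val_one, Matrix.cons_val_two,
    Matrix.head_cons, Matrix.tail_cons]

/-- **EM(corner) on stars**: at every lower-corner state (every vertex and the probe at `K = K_min`),
`(P_star) ≥ (P_{star − e_j})` for every pendant edge `j` (mine-3 §29 (c)–(d), the star case). -/
theorem em_star_corner (x : Option ι → ℝ) (hx : ∀ v, 0 ≤ x v ∧ x v ≤ 1) (j : ι) :
    (star ι).pFun none x (fun v => kMin (x v)) (univ.erase j) ≤
      (star ι).pFun none x (fun v => kMin (x v)) univ := by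
  rw [← sub_nonneg, em_star_eq]
  set S := univ.erase j with hS
  set t : ι → ℝ := fun i => pieceT (x (some i)) with ht_def
  set lo : ι → Fin 3 := fun i => pieceLo (x (some i)) with hlo_def
  set hi : ι → Fin 3 := fun i => pieceHi (x (some i)) with hhi_def
  have hfac := fun i => vertex_factors_eq (hx (some i))
  have ha : ∏ i ∈ S, (3 - x (some i)) = ∏ i ∈ S, ((1 - t i) * aT (lo i) + t i * aT (hi i)) :=
    Finset.prod_congr rfl fun i _ => (hfac i).1
  have hb : ∏ i ∈ S, (1 + (2 - x (some i)) * kMin (x (some i))) =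
      ∏ i ∈ S, ((1 - t i) * bT (lo i) + t i * bT (hi i)) :=
    Finset.prod_congr rfl fun i _ => (hfac i).2.1
  have hc : ∏ i ∈ S, ((2 - x (some i)) * kMin (x (some i)) + x (some i)) =
      ∏ i ∈ S, ((1 - t i) * cT (lo i) + t i * cT (hi i)) :=
    Finset.prod_congr rfl fun i _ => (hfac i).2.2
  obtain ⟨hx1, hβ, hγ⟩ := special_factors_eq (hx (some j))
  have ht : ∀ i, 0 ≤ t i ∧ t i ≤ 1 := fun i => pieceT_mem (hx (some i))
  have htj := pieceT_mem (hx (some j))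
  -- the EM value with the special vertex at type `s`
  set E : Fin 3 → ℝ := fun s =>
    (∏ i ∈ S, ((1 - t i) * aT (lo i) + t i * aT (hi i))) - 2 ^ (Fintype.card ι) * x none * xS s +
    2 * kMin (x none) * (∏ i ∈ S, ((1 - t i) * bT (lo i) + t i * bT (hi i))) * βS s -
    kMin (x none) * x none * (∏ i ∈ S, ((1 - t i) * cT (lo i) + t i * cT (hi i))) * γS s with hE
  have hsplit : (∏ i ∈ S, (3 - x (some i))) - 2 ^ (Fintype.card ι) * x none * x (some j) +
      2 * kMin (x none) * (∏ i ∈ S, (1 + (2 - x (some i)) * kMin (x (some i)))) *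
        ((2 - x (some j)) * kMin (x (some j)) - (1 - x (some j))) -
      kMin (x none) * x none * (∏ i ∈ S, ((2 - x (some i)) * kMin (x (some i)) + x (some i))) *
        ((2 - x (some j)) * kMin (x (some j)) - 2 * (1 - x (some j))) =
      (1 - pieceT (x (some j))) * E (pieceLo (x (some j))) + pieceT (x (some j)) * E (pieceHi (x (some j))) := by
    rw [ha, hb, hc, hE]
    simp only
    linear_combination (-(2 ^ (Fintype.card ι) * x none)) * hx1 +
      (2 * kMin (x none) * ∏ i ∈ S, ((1 - t i) * bT (lo i) + t i * bT (hi i))) * hβ -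
      (kMin (x none) * x none * ∏ i ∈ S, ((1 - t i) * cT (lo i) + t i * cT (hi i))) * hγ
  rw [hsplit]
  -- every `E s ≥ 0` by the tensor expansion
  have hE_nonneg : ∀ s, 0 ≤ E s := by
    intro s
    rw [hE]
    simp only
    rw [prod_affine_eq_sum_finset, prod_affine_eq_sum_finset, prod_affine_eq_sum_finset]
    have hconst : (2 : ℝ) ^ (Fintype.card ι) * x none * xS s =
        ∑ T ∈ S.powerset, ((∏ i ∈ T, t i) * ∏ i ∈ S \ T, (1 - t i)) *
          (2 ^ (Fintype.card ι) * x none * xS s) := by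
      rw [← Finset.sum_mul, sum_weights_eq_one_finset, one_mul]
    rw [hconst]
    simp only [Finset.mul_sum, Finset.sum_mul, ← Finset.sum_sub_distrib, ← Finset.sum_add_distrib]
    refine Finset.sum_nonneg fun T _ => ?_
    have hw := weight_nonneg_finset ht S T
    have hfun : ∀ (f : Fin 3 → ℝ),
        ∏ i ∈ S, (if i ∈ T then f (hi i) else f (lo i)) = ∏ i ∈ S, f (if i ∈ T then hi i else lo i) :=
      fun f => Finset.prod_congr rfl fun i _ => by split_ifs <;> rfl
    rw [hfun aT, hfun bT, hfun cT]
    have hval := emTypeValue_nonneg (S.filter fun i => (if i ∈ T then hi i else lo i) = 2).card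
      (S.filter fun i => (if i ∈ T then hi i else lo i) = 1).card
      (S.filter fun i => (if i ∈ T then hi i else lo i) = 0).card s (hx none)
    rw [← em_type_eq j (fun i => if i ∈ T then hi i else lo i) s] at hval
    have := mul_nonneg hw hval
    convert this using 1
    ring
  exact add_nonneg (mul_nonneg (by linarith [htj.2]) (hE_nonneg _)) (mul_nonneg htj.1 (hE_nonneg _))


end MultiGraph

end PercRepro
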